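import Mathlib
import Literature.MathematicalPhysics.QuantumFieldTheory.Balaban1983to89.B6SectA
import Literature.MathematicalPhysics.QuantumFieldTheory.Balaban1983to89.B4RandomWalk213

/-!
# `Balaban1983to89.B6Eq250` — T. Bałaban, *Propagators and renormalization transformations for lattice gauge
theories. II*, Commun. Math. Phys. **96** (1984) 223–250 [Balaban1984PropagatorsII]: (2.49) ⇒ (2.50), the random-walk
expansion `G′ = G′₀(I − R)⁻¹ = G′₀ Σ_{n≥0} Rⁿ = Σ_ω h_{□₀}G′(□₀)h_{□₀}K(h_{□₁})G′(□₁)h_{□₁}⋯K(h_{□ₙ})G′(□ₙ)h_{□ₙ}` PROVED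

statement-level skeleton of published theorems with citation tags; proofs where landed; nothing here is a claim about the Yang–Mills mass gap.
PDF held: `paper:balaban1984-cmp96-propagators-rt-ii` (journal page = PDF page + 222); p. 229 [PDF 7] and p. 232 [PDF 10] read
from the ×2 renders `run/shared/lean/pub/pub-balaban/b2b-balaban-ref1/pages/1984-cmp96-propagators-rt-II/…-p007/p010-x2.png`.

CITATION HEADER (cell `lit-balaban`, unit `lit-balaban-r03` gen 2, Phase-2 envelope seat p01 of `HOME/PHASE2-TARGETS.md`
§G.3; SKELETON row `B6.Eq2.49` of `HOME/lit-balaban-r03/ROWS-B6.md`; companion of `…Balaban1983to89.B6SectA` (p238845,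
IMPORTED for `B6SectA.generator238` = (2.38)) and of `…Balaban1983to89.B4RandomWalk213` (IMPORTED: the walk-expansion
calculus `bprod`/`walks`/`order_term_eq_sum_walks` written for [3] = B4 (2.12)–(2.13), which is the SAME mechanism)).
WHAT THE PAPER PRINTS (p. 232, verbatim): *"Now let us come back to the inequality (2.44) and its consequences. One of
them follows from the equality (2.38) where the operator R was defined. We get |Rλ| ≤ O(M⁻¹)|λ|, (2.49) thus the
operator R has a small norm in the space L^∞ for M sufficiently large, and we get
G′ = G′₀(I − R)⁻¹ = G′₀ Σ_{n=0}^∞ Rⁿ = Σ_ω h_{□₀}G′(□₀)h_{□₀}K(h_{□₁})G′(□₁)h_{□₁}· … ·K(h_{□ₙ})G′(□ₙ)h_{□ₙ}, (2.50)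
where ω = (□₀, □₁, …, □ₙ), □ᵢ ∈ 𝒟, □ᵢ ∩ □ᵢ₊₁ ≠ ∅. Both series above are convergent in the space L^∞, and in the
Hölder norm ‖·‖_{1,α} also."*; with (2.37) p. 229 *"G′₀ = Σ_{□∈𝒟} h_□G′(□)h_□"* and (2.38) *"Δ′_aG′₀ = I −
Σ_□ K(h_□)G′(□)h_□ = I − R"*, (2.36) *"Σ_{□∈𝒟} h_□² = 1"*.
WHAT IS PROVED HERE (0 sorry, 0 named facts), over an arbitrary ring of operators `𝔄` (for the convergence clauses: a
normed ring with summable geometric series, e.g. any complete normed ring — the bounded operators on L^∞ or on the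
Hölder space are such rings, so ONE abstract statement covers both printed norms) and a finite family of cubes `ι = 𝒟`:
(i) `eq238` — (2.38) for `K(h) := hΔ′_a − Δ′_ah` (the commutator whose lattice form is the printed (2.39)), from (2.36)
and the local-inverse property `h_□Δ′_aG′(□)h_□ = h_□²` (this is `B6SectA.generator238` at `s = univ`);
(ii) `series_right_inverse` — for `‖R‖ < 1` ((2.49) with M large) the series `G′₀Σ_nRⁿ` converges and is a RIGHT
INVERSE of `Δ′_a`: `Δ′_a(G′₀Σ_nRⁿ) = 1`, with no a-priori inverse assumed;
(iii) **`neumann250`** — if `G′` is the inverse of `Δ′_a` (only `G′Δ′_a = 1` is used; in print G′ = Δ′_a⁻¹ exists by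
the positivity (2.11)), then `G′ = G′₀(I − R)⁻¹` (`neumann250_units`, `(I − R)⁻¹` = Mathlib `Units.oneSub`),
`G′ = G′₀Σ'_nRⁿ` (`neumann250_tsum`) and the series CONVERGES to `G′` (`neumann250` as a `HasSum`);
(iv) `order_term_eq_sum_walks250` — the third equality of (2.50) at every order: under LOCALITY (`h_□h_□′ = 0` and
`h_□Δ′_ah_□′ = 0` whenever `□ ∩ □′ = ∅`, typed for an arbitrary reflexive-or-not "touch" relation) the order-n term
`G′₀Rⁿ` is the sum over walks ω = (□₀,…,□ₙ) with □ᵢ ∩ □ᵢ₊₁ ≠ ∅ of the printed products, and `neumann250_walks` — the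
walk series converges to `G′`;
(v) `norm_lt_one_of_large` — the arithmetic of *"(2.49) thus R has a small norm … for M sufficiently large"*.
NOT proved here (inputs, exactly as in print): the bound (2.49) itself (it is (2.44), row `B6.Eq2.44`, typed in
`B6RandomWalkHom`), the existence of Δ′_a⁻¹ (positivity (2.11)), and the identification of `𝔄` with the operator
algebra of L^∞(T_η) / of the Hölder space.
-/

namespace Literature.MathematicalPhysics.QuantumFieldTheory.Balaban1983to89.B6Eq250

open Finset
open B4RandomWalk213 (bprod walks IsWalk)

/-! ## §1. The objects of (2.37)–(2.38) in a ring of operators, and (2.38) -/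

section Ring

variable {𝔄 : Type*} [Ring 𝔄] {ι : Type*}

/-- `K(h) := hΔ′_a − Δ′_ah`, the operator of (2.38) (its explicit lattice form is the printed (2.39)): with it
`Δ′_a(h_□G′(□)h_□) = h_□² − K(h_□)G′(□)h_□` whenever `G′(□)` inverts `Δ′_a` on the support of `h_□`.
[cite: Balaban1984PropagatorsII, (2.38)–(2.39) p.229] -/
def kOp (D h : 𝔄) : 𝔄 := h * D - D * h

/-- unfolding `kOp`. [cite: Balaban1984PropagatorsII, (2.38)–(2.39) p.229] -/
theorem kOp_def (D h : 𝔄) : kOp D h = h * D - D * h := rfl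

variable [Fintype ι]

/-- `G′₀ = Σ_{□∈𝒟} h_□G′(□)h_□` (2.37), for a finite family `𝒟 = ι` of cubes with cut-offs `h` and local inverses `g`.
[cite: Balaban1984PropagatorsII, (2.37) p.229] -/
def gZero (h g : ι → 𝔄) : 𝔄 := ∑ i, h i * g i * h i

/-- `R = Σ_{□∈𝒟} K(h_□)G′(□)h_□` (2.38). [cite: Balaban1984PropagatorsII, (2.38) p.229] -/
def rOp (D : 𝔄) (h g : ι → 𝔄) : 𝔄 := ∑ i, kOp D (h i) * g i * h i

/-- the summand of `G′₀` at `□`: `a_□ = h_□G′(□)h_□`. [cite: Balaban1984PropagatorsII, (2.37) p.229] -/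
def aTerm (h g : ι → 𝔄) (i : ι) : 𝔄 := h i * g i * h i

/-- the summand of `R` at `□`: `b_□ = K(h_□)G′(□)h_□`. [cite: Balaban1984PropagatorsII, (2.38) p.229] -/
def bTerm (D : 𝔄) (h g : ι → 𝔄) (i : ι) : 𝔄 := kOp D (h i) * g i * h i

omit [Fintype ι] in
/-- unfolding `aTerm`. [cite: Balaban1984PropagatorsII, (2.37) p.229] -/
theorem aTerm_apply (h g : ι → 𝔄) (i : ι) : aTerm h g i = h i * g i * h i := rfl

omit [Fintype ι] in
/-- unfolding `bTerm`. [cite: Balaban1984PropagatorsII, (2.38) p.229] -/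
theorem bTerm_apply (D : 𝔄) (h g : ι → 𝔄) (i : ι) : bTerm D h g i = kOp D (h i) * g i * h i := rfl

/-- `G′₀ = Σ_□ a_□`. [cite: Balaban1984PropagatorsII, (2.37) p.229] -/
theorem gZero_eq_sum_aTerm (h g : ι → 𝔄) : gZero h g = ∑ i, aTerm h g i := rfl

/-- `R = Σ_□ b_□`. [cite: Balaban1984PropagatorsII, (2.38) p.229] -/
theorem rOp_eq_sum_bTerm (D : 𝔄) (h g : ι → 𝔄) : rOp D h g = ∑ i, bTerm D h g i := rfl

/-- **(2.38) `Δ′_aG′₀ = I − R`**, from the partition of unity (2.36) `Σ_□ h_□² = 1` and the local-inverse property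
`h_□Δ′_aG′(□)h_□ = h_□²` (*"G′(□) is an inverse of Δ′_a with some boundary conditions on the boundary of □"*) — this is
`B6SectA.generator238` over the whole finite family `𝒟`. [cite: Balaban1984PropagatorsII, (2.36)–(2.38) p.229] -/
theorem eq238 (D : 𝔄) (h g : ι → 𝔄) (hpart : ∑ i, h i * h i = 1)
    (hloc : ∀ i, h i * D * g i * h i = h i * h i) : D * gZero h g = 1 - rOp D h g := by
  unfold gZero rOp kOp
  exact B6SectA.generator238 (s := Finset.univ) h g D hpart fun i _ => hloc i

/-- (2.38) read as `G′(I − R) = G′₀` for any left inverse `G′` of `Δ′_a`: the algebra behind the first equality of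
(2.50). [cite: Balaban1984PropagatorsII, (2.38) p.229, (2.50) p.232] -/
theorem left_inverse_mul_one_sub (D Gp : 𝔄) (h g : ι → 𝔄) (hGD : Gp * D = 1) (hpart : ∑ i, h i * h i = 1)
    (hloc : ∀ i, h i * D * g i * h i = h i * h i) : Gp * (1 - rOp D h g) = gZero h g :=
  B4RandomWalk213.G_mul_one_sub_eq hGD (eq238 D h g hpart hloc)

end Ring

/-! ## §2. (2.49) ⇒ (2.50): the Neumann series in a normed ring of operators -/

section Normed

variable {𝔄 : Type*} [NormedRing 𝔄] [HasSummableGeomSeries 𝔄] {ι : Type*} [Fintype ι]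

omit [HasSummableGeomSeries 𝔄] [Fintype ι] in
/-- *"(2.49) |Rλ| ≤ O(M⁻¹)|λ|, thus the operator R has a small norm in the space L^∞ for M sufficiently large"*:
if `‖R‖ ≤ C·M⁻¹` and `M > C`, then `‖R‖ < 1`. [cite: Balaban1984PropagatorsII, (2.49) p.232] -/
theorem norm_lt_one_of_large {R : 𝔄} {C M : ℝ} (hM : 0 < M) (hR : ‖R‖ ≤ C * M⁻¹) (hCM : C < M) : ‖R‖ < 1 := by
  have h1 : C * M⁻¹ < 1 := by
    rw [← div_eq_mul_inv, div_lt_one hM]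
    exact hCM
  exact lt_of_le_of_lt hR h1

/-- For `‖R‖ < 1` the Neumann series `G′₀Σ_nRⁿ` CONVERGES (to `G′₀Σ'_nRⁿ`) — *"Both series above are convergent"*,
first series. [cite: Balaban1984PropagatorsII, (2.50) p.232] -/
theorem hasSum_gZero_mul_pow (D : 𝔄) (h g : ι → 𝔄) (hR : ‖rOp D h g‖ < 1) :
    HasSum (fun n : ℕ => gZero h g * rOp D h g ^ n) (gZero h g * ∑' n : ℕ, rOp D h g ^ n) :=
  (summable_geometric_of_norm_lt_one hR).hasSum.mul_left _

/-- The series constructs a RIGHT INVERSE of `Δ′_a` outright: `Δ′_a(G′₀Σ'_nRⁿ) = (I − R)Σ'_nRⁿ = I` — (2.38) with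
‖R‖ < 1, no a-priori inverse of `Δ′_a` assumed. [cite: Balaban1984PropagatorsII, (2.38) p.229, (2.50) p.232] -/
theorem series_right_inverse (D : 𝔄) (h g : ι → 𝔄) (hpart : ∑ i, h i * h i = 1)
    (hloc : ∀ i, h i * D * g i * h i = h i * h i) (hR : ‖rOp D h g‖ < 1) :
    D * (gZero h g * ∑' n : ℕ, rOp D h g ^ n) = 1 := by
  rw [← mul_assoc, eq238 D h g hpart hloc, mul_neg_geom_series _ hR]

/-- **(2.50), first equality: `G′ = G′₀(I − R)⁻¹`**, with `(I − R)⁻¹` the inverse of the unit `I − R` (‖R‖ < 1;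
Mathlib `Units.oneSub`), for `G′` the inverse of `Δ′_a` (only `G′Δ′_a = I` is used).
[cite: Balaban1984PropagatorsII, (2.50) p.232] -/
theorem neumann250_units (D Gp : 𝔄) (h g : ι → 𝔄) (hGD : Gp * D = 1) (hpart : ∑ i, h i * h i = 1)
    (hloc : ∀ i, h i * D * g i * h i = h i * h i) (hR : ‖rOp D h g‖ < 1) :
    Gp = gZero h g * ↑(Units.oneSub (rOp D h g) hR)⁻¹ := by
  have key : Gp * (Units.oneSub (rOp D h g) hR : 𝔄) = gZero h g := by
    rw [Units.val_oneSub]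
    exact left_inverse_mul_one_sub D Gp h g hGD hpart hloc
  rw [← key, Units.mul_inv_cancel_right]

/-- **(2.50), second equality: `G′ = G′₀Σ_{n=0}^∞ Rⁿ`** (as the sum of the convergent series).
[cite: Balaban1984PropagatorsII, (2.50) p.232] -/
theorem neumann250_tsum (D Gp : 𝔄) (h g : ι → 𝔄) (hGD : Gp * D = 1) (hpart : ∑ i, h i * h i = 1)
    (hloc : ∀ i, h i * D * g i * h i = h i * h i) (hR : ‖rOp D h g‖ < 1) :
    Gp = gZero h g * ∑' n : ℕ, rOp D h g ^ n := by
  rw [neumann250_units D Gp h g hGD hpart hloc hR]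
  rfl

/-- **(2.49) ⇒ (2.50): `G′ = G′₀(I − R)⁻¹ = G′₀Σ_{n≥0}Rⁿ`, the series converging to `G′`** in the operator norm of `𝔄`
(any normed ring of operators with summable geometric series — in print: the bounded operators on L^∞, resp. on the
Hölder space ‖·‖_{1,α}). Hypotheses: (2.36), the local-inverse property of the `G′(□)`, `G′Δ′_a = I`, and ‖R‖ < 1
(= (2.49) for M large, `norm_lt_one_of_large`). [cite: Balaban1984PropagatorsII, (2.49)–(2.50) p.232] -/
theorem neumann250 (D Gp : 𝔄) (h g : ι → 𝔄) (hGD : Gp * D = 1) (hpart : ∑ i, h i * h i = 1)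
    (hloc : ∀ i, h i * D * g i * h i = h i * h i) (hR : ‖rOp D h g‖ < 1) :
    HasSum (fun n : ℕ => gZero h g * rOp D h g ^ n) Gp := by
  rw [neumann250_tsum D Gp h g hGD hpart hloc hR]
  exact hasSum_gZero_mul_pow D h g hR

/-- Uniqueness behind (2.50): with ‖R‖ < 1, ANY left inverse of `Δ′_a` equals the series (left inverse = the right
inverse constructed in `series_right_inverse`); in particular the inverse `Δ′_a⁻¹` of print is this series.
[cite: Balaban1984PropagatorsII, (2.50) p.232] -/
theorem left_inverse_eq_series (D Gp : 𝔄) (h g : ι → 𝔄) (hGD : Gp * D = 1) (hpart : ∑ i, h i * h i = 1)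
    (hloc : ∀ i, h i * D * g i * h i = h i * h i) (hR : ‖rOp D h g‖ < 1) :
    Gp = gZero h g * ∑' n : ℕ, rOp D h g ^ n := by
  have := series_right_inverse D h g hpart hloc hR
  calc Gp = Gp * (D * (gZero h g * ∑' n : ℕ, rOp D h g ^ n)) := by rw [this, mul_one]
    _ = gZero h g * ∑' n : ℕ, rOp D h g ^ n := by rw [← mul_assoc, hGD, one_mul]

end Normed

/-! ## §3. The third equality of (2.50): the expansion over walks `ω = (□₀, …, □ₙ)`, `□ᵢ ∩ □ᵢ₊₁ ≠ ∅` -/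

section Walks

variable {𝔄 : Type*} [Ring 𝔄] {ι : Type*}

/-- LOCALITY ⇒ the vanishing used in (2.50): if `h_□h_□′ = 0` and `h_□Δ′_ah_□′ = 0` for two cubes that do not touch
(`□ ∩ □′ = ∅`: the cut-offs have disjoint supports and `Δ′_a` does not couple them), then
`a_□b_□′ = h_□G′(□)h_□K(h_□′)G′(□′)h_□′ = 0`. [cite: Balaban1984PropagatorsII, (2.50) p.232] -/
theorem aTerm_mul_bTerm_eq_zero (D : 𝔄) (h g : ι → 𝔄) {i l : ι} (hhh : h i * h l = 0)
    (hDh : h i * D * h l = 0) : aTerm h g i * bTerm D h g l = 0 := by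
  have : h i * kOp D (h l) = 0 := by
    rw [kOp_def, mul_sub, ← mul_assoc, hhh, zero_mul, ← mul_assoc, hDh, sub_zero]
  rw [aTerm_apply, bTerm_apply, show h i * g i * h i * (kOp D (h l) * g l * h l) =
      h i * g i * (h i * kOp D (h l)) * g l * h l by noncomm_ring, this]
  simp

/-- LOCALITY ⇒ `b_□b_□′ = K(h_□)G′(□)h_□K(h_□′)G′(□′)h_□′ = 0` for non-touching cubes.
[cite: Balaban1984PropagatorsII, (2.50) p.232] -/
theorem bTerm_mul_bTerm_eq_zero (D : 𝔄) (h g : ι → 𝔄) {i l : ι} (hhh : h i * h l = 0)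
    (hDh : h i * D * h l = 0) : bTerm D h g i * bTerm D h g l = 0 := by
  have : h i * kOp D (h l) = 0 := by
    rw [kOp_def, mul_sub, ← mul_assoc, hhh, zero_mul, ← mul_assoc, hDh, sub_zero]
  rw [bTerm_apply, bTerm_apply, show kOp D (h i) * g i * h i * (kOp D (h l) * g l * h l) =
      kOp D (h i) * g i * (h i * kOp D (h l)) * g l * h l by noncomm_ring, this]
  simp

variable [Fintype ι]

/-- **(2.50), third equality, at order `n`:** under LOCALITY the order-`n` term of the Neumann series is the sum
over WALKS only, `G′₀Rⁿ = Σ_{□₀} Σ_{(□₁,…,□ₙ): □ᵢ∩□ᵢ₊₁≠∅} h_{□₀}G′(□₀)h_{□₀}K(h_{□₁})G′(□₁)h_{□₁}⋯K(h_{□ₙ})G′(□ₙ)h_{□ₙ}`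
(`touch □ □′` ↦ `□ ∩ □′ ≠ ∅`; `B4RandomWalk213.walks touch □₀ n` = the tuples (□₁,…,□ₙ) with consecutive cubes
touching, `bprod` = the ordered product of the `b_□ = K(h_□)G′(□)h_□`). [cite: Balaban1984PropagatorsII, (2.50) p.232] -/
theorem order_term_eq_sum_walks250 (touch : ι → ι → Prop) [DecidableRel touch] (D : 𝔄) (h g : ι → 𝔄)
    (hhh : ∀ i l, ¬ touch i l → h i * h l = 0) (hDh : ∀ i l, ¬ touch i l → h i * D * h l = 0) (n : ℕ) :
    gZero h g * rOp D h g ^ n =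
      ∑ i, ∑ ys ∈ walks touch i n, aTerm h g i * bprod (bTerm D h g) n ys := by
  rw [gZero_eq_sum_aTerm, rOp_eq_sum_bTerm]
  exact B4RandomWalk213.order_term_eq_sum_walks touch
    (fun i l hil => aTerm_mul_bTerm_eq_zero D h g (hhh i l hil) (hDh i l hil))
    (fun i l hil => bTerm_mul_bTerm_eq_zero D h g (hhh i l hil) (hDh i l hil)) n

end Walks

section WalkSeries

variable {𝔄 : Type*} [NormedRing 𝔄] [HasSummableGeomSeries 𝔄] {ι : Type*} [Fintype ι]

/-- **(2.50) in full: `G′ = Σ_ω h_{□₀}G′(□₀)h_{□₀}K(h_{□₁})G′(□₁)h_{□₁}⋯K(h_{□ₙ})G′(□ₙ)h_{□ₙ}`**, the sum over walks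
`ω = (□₀, □₁, …, □ₙ)`, `□ᵢ ∈ 𝒟`, `□ᵢ ∩ □ᵢ₊₁ ≠ ∅`, organised by length `n` and CONVERGENT to `G′` — from (2.36), the
local-inverse property, `G′Δ′_a = I`, ‖R‖ < 1 ((2.49), M large) and locality.
[cite: Balaban1984PropagatorsII, (2.50) p.232] -/
theorem neumann250_walks (touch : ι → ι → Prop) [DecidableRel touch] (D Gp : 𝔄) (h g : ι → 𝔄)
    (hGD : Gp * D = 1) (hpart : ∑ i, h i * h i = 1) (hloc : ∀ i, h i * D * g i * h i = h i * h i)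
    (hR : ‖rOp D h g‖ < 1) (hhh : ∀ i l, ¬ touch i l → h i * h l = 0)
    (hDh : ∀ i l, ¬ touch i l → h i * D * h l = 0) :
    HasSum (fun n : ℕ => ∑ i, ∑ ys ∈ walks touch i n, aTerm h g i * bprod (bTerm D h g) n ys) Gp := by
  have hfun : (fun n : ℕ => ∑ i, ∑ ys ∈ walks touch i n, aTerm h g i * bprod (bTerm D h g) n ys) =
      fun n : ℕ => gZero h g * rOp D h g ^ n :=
    funext fun n => (order_term_eq_sum_walks250 touch D h g hhh hDh n).symm
  rw [hfun]
  exact neumann250 D Gp h g hGD hpart hloc hR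

end WalkSeries

end Literature.MathematicalPhysics.QuantumFieldTheory.Balaban1983to89.B6Eq250
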